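import Summits.BirchSwinnertonDyer.Rank1Residual.X2.ClassClosureOfFacts
import Summits.BirchSwinnertonDyer.Rank1Residual.X2.RankOneRegulator
import HarnessLib

/-!
# Class X2c at a NON-SPLIT prime: the Schneider certificate IS `ord_{T=0} L_p(E,T) = 1` under Mazur's
# main conjecture, and EVERY λ-minimal non-split X2c pair closes — `BSD(E,p)` from the two-engine
# `(μ_an, λ_an) = (0, 1)` certificate ALONE, both parity types, no partner, no regulator
# (cell `b2b-bsdres`, unit `b2b-bsdres-eisenstein-p2`, gen 19; consumer: CLASS-CLOSURE row O9)

HONEST FRAMING (run/shared/lean/b2b/bsd-rank1-residual/, verbatim in every file): the goal of the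
cell is to DELETE the COMBINATION-SHAPED residual classes of the Birch–Swinnerton-Dyer formula for
ALL analytic-rank `≤ 1` elliptic curves over `ℚ` — "full BSD formula for every rank `≤ 1` curve in
class `C`" assembled STRICTLY from published theorems — so that the rank-`≤ 1` remainder becomes
exactly the CONSTRUCTION-SHAPED classes, which are TYPED (missing-input `Prop`s), NOT attempted.
This is not "finishing BSD". Research route; NO CLAIM BEYOND STATED CLASSES; nothing here changes
a label; X2c stays CONSTRUCTION-SHAPED. Theorems only: no definition, no new named fact; published
inputs enter as the tree's existing named Literature facts BY NAME; per pair only FINITE `p`-adic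
`L`-series certificates (`X2.AnalyticMuLE W p 0`, `X2.AnalyticLambdaEq W p 1`, or `ord_{T=0} L = 1`).

WHAT. cc-typer-6's O9 theorems (`X2/ClassClosureO9`) close a non-split X2c pair from Mazur's main
conjecture at the pair and a per-pair "Schneider certificate" `hSch : Reg_p(E, Dh) ≠ 0` for THE
Stein–Wuthrich §4.2 height — a `p`-adic HEIGHT computation (one regulator engine in the cell so far:
tier 2). This file removes the height from the certificate:

* `schneider_of_mazurMainConjectureAt_of_order_eq_one_nonsplit` — at a non-split multiplicative `p`
  with `ord_{s=1} L(E,s) = 1`: Mazur's MC at the pair + `ord_{T=0} L_p(E,T) = 1` for THE non-split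
  Mazur–Tate–Teitelbaum function ⟹ `Reg_p(E,Dh) ≠ 0` for every canonical `Dh` (Stein–Wuthrich Thm. 6.1
  clause "order `= r` iff the height is non-degenerate", `thm61_nonsplitMultiplicative.order_eq_iff`,
  through gen 5's unit-cofactor engine `order_iff_and_shaValuation_eq_of_unit`): the Schneider
  certificate is a statement about the `p`-adic `L`-FUNCTION only.
* `bsdp_of_cellC_of_not_split_of_mazurMainConjectureAt_of_orderOne` — X2c ∧ non-split: MC at the pair +
  `ord_{T=0} L_p = 1` ⟹ `BSD(E,p)` (Disegni 2020 Thm. 4 for the leading term).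
* **`bsdp_of_cellC_of_not_split_of_lamMin`** — X2c ∧ non-split ∧ `μ_an = 0` ∧ `λ_an = 1` ⟹ `BSD(E,p)`,
  BOTH parity types, NO Greenberg–Vatsal input, NO congruent partner, NO regulator: λ-minimality gives
  Mazur's MC at the pair (gen 4 `cellC_mazurMainConjectureAt_of_lamMin`: Kato–Wuthrich divisibility +
  squeeze) AND Schneider (gen 5 `schneider_and_shaIdentity_of_lamMin_nonsplit`), Disegni 2020 Thm. 4
  (typed 2026-08-21) supplies the analytic leading term, Stein–Wuthrich Thm. 6.1 the algebraic one.
  Before Disegni's theorem entered the tree these pairs needed a regulator VALUE (gen 5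
  `bsdp_iff_regulatorValuation_of_lamMin_nonsplit`, tier 2); now the two-engine `(μ_an, λ_an)` census
  certificate closes them at tier 1.
* `bsdp_of_cellC_of_not_split_of_gvPar_of_orderOne_of_facts` — the GV-parity sub-cell with the
  `L`-function certificate in place of `hSch`, all class-level inputs registered facts (gen 18/19).
* `order_eq_one_of_schneider_nonsplit` — conversely Schneider ⟹ `ord_{T=0} L_p = 1` (Disegni), so under
  MC at the pair the two per-pair certificates are EQUIVALENT.

References: [SteinWuthrich2013] Thm. 6.1 (p. 20), §3.1, §4.2; [Disegni2020] Thm. 4 (§3.2);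
[Wuthrich2014] Thm. 16; [GreenbergVatsal2000] p. 4 (λ-invariants); [Miller2011LMS] Def. 1.1, Prop. 7.6;
HOME/b2b-bsdres-eisenstein-p2/X2-GAP.md §24; HOME/class-closure/O9/.
-/

set_option autoImplicit false

noncomputable section

open scoped Classical MatrixGroups ModularForm

open PowerSeries CongruenceSubgroup WeierstrassCurve Literature.NumberTheory.EllipticCurves
  Literature.NumberTheory.EllipticCurves.ModularForms
  Literature.NumberTheory.EllipticCurves.Rank1Residual
  Literature.NumberTheory.EllipticCurves.Rank1Residual.Typed
  Literature.NumberTheory.EllipticCurves.GreenbergVatsal2000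
  Literature.NumberTheory.EllipticCurves.Wuthrich2014
  Literature.NumberTheory.EllipticCurves.SteinWuthrich2013
  Literature.NumberTheory.EllipticCurves.Disegni2020
  Summit.BirchSwinnertonDyer.Rank1Residual.X2.GreenbergVatsalInputsOfFacts

namespace Summit.BirchSwinnertonDyer.Rank1Residual.X2

variable (W : WeierstrassCurve ℚ) [W.IsElliptic] [W.IsGloballyMinimal] (p : ℕ) [Fact p.Prime]

/-! ## §1. Under Mazur's MC: `ord_{T=0} L_p = 1` ⟹ Schneider -/

/-- **The Schneider certificate is `ord_{T=0} L_p(E,T) = 1`.** At an odd non-split multiplicative `p`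
with `ord_{s=1} L(E,s) = 1`, Mazur's main conjecture at the pair (`X2.MazurMainConjectureAt W p`) and
`ord_{T=0} L = 1` for THE non-split Mazur–Tate–Teitelbaum function `L` of the newform of `W` give
`Reg_p(E, Dh) ≠ 0` for every height datum `Dh` canonical at a Tate parameter (`IsMultCanonical`):
`char_Λ X = (g)`, `ι(g·w) = ϖ·L` (MC), so `ord_{T=0} g = ord_{T=0} L = 1 = rank E(ℚ)` (gen 5's engine
`order_iff_and_shaValuation_eq_of_unit`, GZK), and Stein–Wuthrich Thm. 6.1 says `ord_{T=0} g = r` iff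
the §4.2 height is non-degenerate (`thm61_nonsplitMultiplicative.order_eq_iff`). No height is computed.
[cite: SteinWuthrich2013, Thm. 6.1 (p. 20), §3.1 (p. 9), §4.2] [cite: Miller2011LMS, Prop. 7.6] -/
theorem schneider_of_mazurMainConjectureAt_of_order_eq_one_nonsplit
    (hJn : thm61_nonsplitMultiplicative) (hGZK : rank_eq_analyticRank_of_analyticRank_le_one)
    (hpar : nonempty_modularParametrizationData)
    (hp2 : p ≠ 2) (hr : W.analyticRank = 1) (hMC : MazurMainConjectureAt W p)
    (hmult : W.HasMultiplicativeReductionAtPrime p) (hns : ¬ W.HasSplitMultiplicativeReductionAtPrime p)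
    {q : ℚ_[p]} (hq0 : q ≠ 0) (hq1 : ‖q‖ < 1) (hqj : tateJ q = (W.j : ℚ_[p]))
    {Dh : PAdicHeightData W p} (hDh : IsMultCanonical Dh q)
    (hordL : ∀ {N : ℕ} [NeZero N] (f : CuspForm (Gamma0 N) 2), IsNewformOf W f →
      ∀ (ϖ : ℚ), (ϖ : ℝ) * W.realPeriodRat = plusPeriod f →
      ∀ L : PowerSeries ℚ_[p], IsMultPAdicLFunctionOf f p (-1) L → L.order = ((1 : ℕ) : ℕ∞)) :
    SchneiderConjecture Dh := by
  obtain ⟨κ, hκ, γ, hγ, hγ'⟩ := exists_isCyclotomic_isTopGenerator_isCyclotomicVariable_holds p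
  obtain ⟨D⟩ := W.nonempty_selmerDualData_holds κ γ hγ
  haveI : NeZero (W.conductorNorm ℤ) := ⟨(W.conductorNorm_pos_holds).ne'⟩
  obtain ⟨Dm⟩ := hpar W
  obtain ⟨ϖ, hϖpos, hϖ, -⟩ := Dm.exists_rat_mul_realPeriodRat_eq_plusPeriod
  obtain ⟨L, hL⟩ := exists_isMultPAdicLFunctionOf_neg_one_of_nonsplit Dm.isNewformOf hmult hns
  haveI : Module.Finite (IwasawaAlgebra p) D.X := D.module_finite_holds hγ
  obtain ⟨hX, g, hchar, -, hnsp⟩ := hMC κ γ hκ hγ hγ' Dm.f Dm.isNewformOf D ϖ hϖ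
  obtain ⟨w, hw⟩ := hnsp hns L hL
  have hι : PowerSeries.C ((ϖ : ℚ) : ℚ_[p]) * L =
      PowerSeries.X ^ 0 * iwasawaToPowerSeries p (g * w) := by
    rw [← hw, pow_zero, one_mul]
  obtain ⟨hrank, hfinsha⟩ := hGZK W hr.le
  have hrank1 : W.mordellWeilRank = 1 := by rw [hrank, hr]
  have hϖQ : ((ϖ : ℚ) : ℚ_[p]) ≠ 0 := by exact_mod_cast hϖpos.ne'
  have hc0 : (W.tamagawaProduct : ℚ_[p]) ≠ 0 := by exact_mod_cast (W.tamagawaProduct_pos').ne'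
  have hA0 : (2 : ℚ_[p]) * (W.tamagawaProduct : ℚ_[p]) ≠ 0 := mul_ne_zero two_ne_zero hc0
  have hXk := thm61_nonsplitMultiplicative.X_pow_dvd hJn hp2 hmult hns hq0 hq1 hqj hκ hγ hγ' D hX
    hDh hchar
  have hS2 := thm61_nonsplitMultiplicative.order_eq_iff hJn hp2 hmult hns hq0 hq1 hqj hκ hγ hγ' D
    hX hDh hchar
  obtain ⟨hord, -⟩ := order_iff_and_shaValuation_eq_of_unit W p g w L _ hϖQ 0 W.mordellWeilRank hι
    _ _ (padicRegulator Dh) hA0 hXk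
    (hJn.leadingTerm_shape hp2 hmult hns hq0 hq1 hqj hκ hγ hγ' D hX hDh g hchar)
  rw [Nat.add_zero] at hord
  have hordL1 : L.order = (W.mordellWeilRank : ℕ) := by
    rw [hrank1]; exact hordL Dm.f Dm.isNewformOf ϖ hϖ L hL
  exact (hS2.mp (hord.mp hordL1)).1

/-- **Conversely, Schneider ⟹ `ord_{T=0} L_p = 1`** at a non-split X2c-type pair (odd non-split
multiplicative `p`, `ord_{s=1} L(E,s) = 1`), by Disegni 2020 Thm. 4 (first clause: `Reg_p ≠ 0 →
ord_{T=0} L = 1`) for THE §4.2 height at THE Tate parameter (`hHn`): so under Mazur's MC at the pair the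
two per-pair certificates "`ord_{T=0} L_p = 1`" and "`Reg_p ≠ 0`" are EQUIVALENT
(`schneider_of_mazurMainConjectureAt_of_order_eq_one_nonsplit` is the other direction).
[cite: Disegni2020, Thm. 4 (§3.2)] [cite: SteinWuthrich2013, §4.2] [cite: GrossZagier1986, Thm. I.(7.3) 2)] -/
theorem order_eq_one_of_schneider_nonsplit (hDis : padicBSD_rankOne_nonsplitMult)
    (hHn : exists_isMultCanonical) (hGZ : GrossZagier1986_thm_I_7_3)
    (hGZK : rank_eq_analyticRank_of_analyticRank_le_one)
    (hp2 : p ≠ 2) (hr : W.analyticRank = 1)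
    (hmult : W.HasMultiplicativeReductionAtPrime p) (hns : ¬ W.HasSplitMultiplicativeReductionAtPrime p)
    (hSch : ∀ (q : ℚ_[p]) (Dh : PAdicHeightData W p), q ≠ 0 → ‖q‖ < 1 → tateJ q = (W.j : ℚ_[p]) →
      IsMultCanonical Dh q → SchneiderConjecture Dh)
    {N : ℕ} [NeZero N] (f : CuspForm (Gamma0 N) 2) (hf : IsNewformOf W f)
    (ϖ : ℚ) (hϖ : (ϖ : ℝ) * W.realPeriodRat = plusPeriod f)
    (L : PowerSeries ℚ_[p]) (hL : IsMultPAdicLFunctionOf f p (-1) L) :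
    L.order = ((1 : ℕ) : ℕ∞) := by
  obtain ⟨κ, hκ, γ, hγ, hγ'⟩ := exists_isCyclotomic_isTopGenerator_isCyclotomicVariable_holds p
  obtain ⟨q, ⟨hq0, hq1, hqj⟩, -⟩ := existsUnique_tateJ_eq_of_one_lt_norm
    (one_lt_norm_j_of_hasMultiplicativeReductionAtPrime (W := W) (p := p) hmult)
  obtain ⟨Dh, hDh⟩ := hHn W p hp2 hmult hns q hq0 hq1 hqj
  obtain ⟨s, hs⟩ := exists_rat_shaAn_eq_of_analyticRank_eq_one hGZ hGZK W hr
  exact ((hDis W p hp2 hmult hns hr κ γ hκ hγ hγ' f hf ϖ hϖ L hL q hq0 hq1 hqj Dh hDh s hs).2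
    (hSch q Dh hq0 hq1 hqj hDh)).1

/-! ## §2. X2c ∧ non-split: closures with an `L`-function certificate in place of the height -/

/-- **X2c, NON-SPLIT `p`: Mazur's MC at the pair + `ord_{T=0} L_p(E,T) = 1` ⟹ `BSD(E,p)`** —
cc-typer-6's `bsdp_of_cellC_of_not_split_of_mazurMainConjectureAt_of_schneider` with its per-pair
height certificate `hSch` DISCHARGED from the `L`-function certificate (§1). Published inputs:
Disegni 2020 Thm. 4 (`hDis`), Stein–Wuthrich Thm. 6.1 + §4.2 (`hJn`, `hHn`), Gross–Zagier (`hGZ`), GZK,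
modularity (`hpar`). [cite: Disegni2020, Thm. 4 (§3.2)] [cite: SteinWuthrich2013, Thm. 6.1 (p. 20), §3.1 (p. 9), §4.2]
[cite: Miller2011LMS, Def. 1.1 and Prop. 7.6] -/
theorem bsdp_of_cellC_of_not_split_of_mazurMainConjectureAt_of_orderOne
    (hDis : padicBSD_rankOne_nonsplitMult) (hJn : thm61_nonsplitMultiplicative)
    (hHn : exists_isMultCanonical) (hGZ : GrossZagier1986_thm_I_7_3)
    (hGZK : rank_eq_analyticRank_of_analyticRank_le_one) (hpar : nonempty_modularParametrizationData)
    (hc : CellC W p) (hns : ¬ W.HasSplitMultiplicativeReductionAtPrime p)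
    (hMC : MazurMainConjectureAt W p)
    (hordL : ∀ {N : ℕ} [NeZero N] (f : CuspForm (Gamma0 N) 2), IsNewformOf W f →
      ∀ (ϖ : ℚ), (ϖ : ℝ) * W.realPeriodRat = plusPeriod f →
      ∀ L : PowerSeries ℚ_[p], IsMultPAdicLFunctionOf f p (-1) L → L.order = ((1 : ℕ) : ℕ∞)) :
    BSDp W p :=
  bsdp_of_cellC_of_not_split_of_mazurMainConjectureAt_of_schneider W p hDis hJn hHn hGZ hGZK hpar hc hns
    hMC (fun _ _ hq0 hq1 hqj hDh ↦ schneider_of_mazurMainConjectureAt_of_order_eq_one_nonsplit W p hJn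
      hGZK hpar hc.2.1 hc.1 hMC hc.2.2.2 hns hq0 hq1 hqj hDh hordL)

/-- **EVERY λ-MINIMAL NON-SPLIT X2c PAIR CLOSES: X2c ∧ non-split ∧ `μ_an(E,p) = 0` ∧ `λ_an(E,p) = 1`
⟹ `BSD(E,p)`** — BOTH parity types (no `GVPar`, no Greenberg–Vatsal input), NO congruent partner, NO
`p`-adic height or regulator. λ-minimality (the two FINITE checks `X2.AnalyticMuLE W p 0`,
`X2.AnalyticLambdaEq W p 1` on THE Mazur–Tate–Teitelbaum function) gives Mazur's main conjecture at the
pair (gen 4 `cellC_mazurMainConjectureAt_of_lamMin`: Kato's divisibility in Wuthrich's integral form,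
Thm. 16, and the λ-squeeze) and Schneider's non-degeneracy for THE §4.2 height (gen 5
`schneider_and_shaIdentity_of_lamMin_nonsplit`); Disegni 2020 Thm. 4 and Stein–Wuthrich Thm. 6.1 then
give `BSD(E,p)` (cc-typer-6's `bsdp_of_cellC_of_not_split_of_mazurMainConjectureAt_of_schneider`).
Class-level inputs, all PUBLISHED named facts: `hDis`, `hWu`, `hJs`/`hJn`, `hHs`/`hHn`, `hGZ`, `hGZK`,
`hpar`. [cite: Disegni2020, Thm. 4 (§3.2)] [cite: Wuthrich2014, Thm. 16 (p. 397)]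
[cite: SteinWuthrich2013, Thm. 6.1 (p. 20), §3.1 (p. 9), §4.2] [cite: GreenbergVatsal2000, p. 4]
[cite: Miller2011LMS, Def. 1.1 and Prop. 7.6] -/
theorem bsdp_of_cellC_of_not_split_of_lamMin
    (hDis : padicBSD_rankOne_nonsplitMult) (hWu : thm16_charIdeal_dvd_multiplicative_of_reducible)
    (hJs : thm61_splitMultiplicative) (hJn : thm61_nonsplitMultiplicative)
    (hHs : exists_isSplitMultCanonical) (hHn : exists_isMultCanonical)
    (hGZ : GrossZagier1986_thm_I_7_3) (hGZK : rank_eq_analyticRank_of_analyticRank_le_one)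
    (hpar : nonempty_modularParametrizationData)
    (hc : CellC W p) (hns : ¬ W.HasSplitMultiplicativeReductionAtPrime p)
    (hμ0 : AnalyticMuLE W p 0) (hlam : AnalyticLambdaEq W p 1) :
    BSDp W p :=
  bsdp_of_cellC_of_not_split_of_mazurMainConjectureAt_of_schneider W p hDis hJn hHn hGZ hGZK hpar hc hns
    (cellC_mazurMainConjectureAt_of_lamMin hWu hJs hJn hHs hHn hGZK W p hc hμ0 (fun _ ↦ hlam)
      (fun hs ↦ absurd hs hns))
    (fun _ _ hq0 hq1 hqj hDh ↦ (schneider_and_shaIdentity_of_lamMin_nonsplit hWu hJn hGZK hpar W p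
      hc.2.1 hc.2.2.2 hns hc.2.2.1 hc.1 hq0 hq1 hqj hDh hμ0 hlam).1)

/-- **O9 sub-cell `CellCNonsplitGV` with the `L`-function certificate**: X2c ∧ non-split ∧ GV parity ∧
`ord_{T=0} L_p(E,T) = 1` ⟹ `BSD(E,p)`, every class-level input a REGISTERED Literature fact (Mazur's MC
from gens 16–18's derivation, `mazurMainConjectureAt_of_gvPar_of_facts`; leading terms Disegni /
Stein–Wuthrich). The per-pair certificate is a statement about THE `p`-adic `L`-function only.
[cite: GreenbergVatsal2000, Thm. (1.3) with §2 pp. 28–30, §3 Thm. (3.11), Cor. (3.8)]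
[cite: Disegni2020, Thm. 4 (§3.2)] [cite: SteinWuthrich2013, Thm. 6.1 (p. 20), §4.2]
[cite: Wuthrich2014, Thm. 16 (p. 397)] -/
theorem bsdp_of_cellC_of_not_split_of_gvPar_of_orderOne_of_facts
    (hT : Silverman1994_thmV53_tateUniformisation.{0})
    (hT' : Silverman1994_thmV53_corV54_tateUniformisation.{0})
    (hA : lambda_nonPrimitive_eq_add_sum_delta_multiplicative)
    (hB : datumSelmer_divisible_of_finite_torsionBy)
    (hF : datumStrictSelmer_lt_datumSelmer_of_split)
    (hG : Greenberg1999.prop510_isTorsion_hasUnitContent_of_gvPar)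
    (hLiftF : residualEpsilon_surjOn_of_lineRamifiedEven)
    (hAnF : nonPrimitive_unitContent_and_lambda_eq_residual_of_lineRamifiedEven)
    (hP : cor38_realPeriodRat_eq_unit_mul_of_isIsogenous_of_gvPar)
    (hWu : thm16_charIdeal_dvd_multiplicative_of_reducible)
    (hDis : padicBSD_rankOne_nonsplitMult) (hJn : thm61_nonsplitMultiplicative)
    (hHn : exists_isMultCanonical) (hGZ : GrossZagier1986_thm_I_7_3)
    (hGZK : rank_eq_analyticRank_of_analyticRank_le_one) (hpar : nonempty_modularParametrizationData)
    (hc : CellCNonsplitGV W p)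
    (hordL : ∀ {N : ℕ} [NeZero N] (f : CuspForm (Gamma0 N) 2), IsNewformOf W f →
      ∀ (ϖ : ℚ), (ϖ : ℝ) * W.realPeriodRat = plusPeriod f →
      ∀ L : PowerSeries ℚ_[p], IsMultPAdicLFunctionOf f p (-1) L → L.order = ((1 : ℕ) : ℕ∞)) :
    BSDp W p :=
  bsdp_of_cellC_of_not_split_of_mazurMainConjectureAt_of_orderOne W p hDis hJn hHn hGZ hGZK hpar hc.1
    hc.2.1 (mazurMainConjectureAt_of_gvPar_of_facts hT hT' hA hB hF hG hLiftF hAnF hP hWu W p hc.1.2.1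
      hc.1.2.2.2 hc.2.2) hordL

/-- **Under Mazur's MC at a non-split X2c pair, the two certificates are equivalent**:
`(ord_{T=0} L_p = 1 for THE non-split function) ↔ (Reg_p ≠ 0 for THE §4.2 height at every Tate
parameter)`. [cite: Disegni2020, Thm. 4 (§3.2)] [cite: SteinWuthrich2013, Thm. 6.1 (p. 20), §4.2] -/
theorem orderOne_iff_schneider_of_mazurMainConjectureAt_nonsplit
    (hDis : padicBSD_rankOne_nonsplitMult) (hJn : thm61_nonsplitMultiplicative)
    (hHn : exists_isMultCanonical) (hGZ : GrossZagier1986_thm_I_7_3)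
    (hGZK : rank_eq_analyticRank_of_analyticRank_le_one) (hpar : nonempty_modularParametrizationData)
    (hc : CellC W p) (hns : ¬ W.HasSplitMultiplicativeReductionAtPrime p)
    (hMC : MazurMainConjectureAt W p) :
    (∀ {N : ℕ} [NeZero N] (f : CuspForm (Gamma0 N) 2), IsNewformOf W f →
      ∀ (ϖ : ℚ), (ϖ : ℝ) * W.realPeriodRat = plusPeriod f →
      ∀ L : PowerSeries ℚ_[p], IsMultPAdicLFunctionOf f p (-1) L → L.order = ((1 : ℕ) : ℕ∞)) ↔
    (∀ (q : ℚ_[p]) (Dh : PAdicHeightData W p), q ≠ 0 → ‖q‖ < 1 → tateJ q = (W.j : ℚ_[p]) →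
      IsMultCanonical Dh q → SchneiderConjecture Dh) :=
  ⟨fun h _ _ hq0 hq1 hqj hDh ↦ schneider_of_mazurMainConjectureAt_of_order_eq_one_nonsplit W p hJn hGZK
      hpar hc.2.1 hc.1 hMC hc.2.2.2 hns hq0 hq1 hqj hDh h,
   fun h _ _ f hf ϖ hϖ L hL ↦ order_eq_one_of_schneider_nonsplit W p hDis hHn hGZ hGZK hc.2.1 hc.1
      hc.2.2.2 hns h f hf ϖ hϖ L hL⟩

end Summit.BirchSwinnertonDyer.Rank1Residual.X2

end
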